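import Summits.SmoothPoincare4.SmoothPoincare4.Theorems.EntropyRungConicalGapCurvatureLevelFence
import Summits.SmoothPoincare4.SmoothPoincare4.Theorems.EntropyRungConicalGapRicciMomentIdentity
import HarnessLib

/-!
# The Ricci-level fence `Θ ≤ a·e^{ρ/2}` (line `Sketch` of crux `EntropyRung.ConicalGap`,
# stmt-SmoothPoincare4-16589; lead seat c4, wave 1)

Helpers `helper_density_le_of_ricciLevel` and `helper_conicalGap_of_ricciLevel`.

On a complete connected normalised 4-d gradient shrinking Ricci soliton `(M, g, f)`
(`Ric + Hess f = g/2`, `R + |∇f|² = f`, closed `g`-balls compact) write, for a scale `τ > 0` and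
`v = e^{-f/τ}` (all integrals `dV`),

  `Z = ∫ v`, `B = ∫ R v`, `C = ∫ f R v`, `D = ∫ R² v`, `A = ∫ |Ric|² v`, `m(τ) = τ B/Z`.

The Ricci moment identity (`ricciMoment_riemVolume`, p132292; GIVEN the integrability of `|Ric|² v`
and of `g⁻¹(dR, df) v` — hypothesis `hInt` here) reads
`2A = B + (τ − 1)[τ⁻²(C − D) − τ⁻¹(2B − D)]`, i.e. after multiplication by `τ²`,

  `(τ − 1)(C − τ B) = 2τ² A − (τ − 1)² D − τ B`     (`ricciLevel_excess_mul_eq`).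

Hence the RICCI-LEVEL CONDITION `(τ − 1)² D + τ B ≤ 2τ² A` for `τ > 1` (hypothesis `hRL`) is, for
`τ > 1`, exactly the curvature-level sign condition `P(τ) : 0 ≤ ∫ (f − τ) R v = C − τ B`
(`ricciLevel_excess_nonneg`); `P` at `τ > 1` makes the cone-excess profile `m` non-decreasing on
`[1, ∞)` (`coneExcessMono_monotoneOn_of_Ioi`, the proof of `coneExcessMono_monotoneOn`, p132548, which
only uses `P` in the interior), and the half-sup fence for a non-decreasing profile
(`HalfSup.density_le_of_monotone`, p131843) gives `∫ e^{-f} dV ≤ 16π² · a · e^{ρ/2}` whenever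
`(16π²T²)⁻¹ ∫ e^{-f/T} → a` and `T⟨R⟩_T → ρ` (`helper_density_le_of_ricciLevel`), and the crux
conclusion `∫⁻ e^{-f} dV ≤ 32π²√π e^{-3/2}` on the sub-class `16π² a e^{ρ/2} ≤ 32π²√π e^{-3/2}`
(`helper_conicalGap_of_ricciLevel`, as `helper_conicalGap_of_curvatureLevel`).

Everything here is proved; no definition and no named fact is introduced or assumed.

## References

* Y. Wang, G. Wang (Wang–Wang 2023), arXiv:2308.06560, Prop. 2.6.
* O. Munteanu, J. Wang, arXiv:1606.01861, §2 (the Ricci moment identity). [MunteanuWang2016]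
-/

noncomputable section

-- `Summit.SmoothPoincare4.SmoothPoincare4.…` (summit = problem) trips `dupNamespace` on every decl.
set_option linter.dupNamespace false

open scoped Manifold ContDiff ENNReal NNReal Topology
open MeasureTheory Set Filter
open Literature.Geometry.Lorentzian Literature.Geometry.Riemannian

namespace Summit.SmoothPoincare4.SmoothPoincare4.Theorems.ConicalGapSketch

/-! ## The Ricci moment identity multiplied by `τ²` (pure algebra) -/

/-- **The Ricci moment identity, cleared of denominators**: if `τ ≠ 0` and
`2A = B + (τ − 1)[τ⁻²(C − D) − τ⁻¹(2B − D)]`, then `(τ − 1)(C − τB) = 2τ²A − (τ − 1)²D − τB`. -/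
theorem ricciLevel_excess_mul_eq {A B C D τ : ℝ} (hτ : τ ≠ 0)
    (hid : 2 * A = B + (τ - 1) * ((τ ^ 2)⁻¹ * (C - D) - τ⁻¹ * (2 * B - D))) :
    (τ - 1) * (C - τ * B) = 2 * τ ^ 2 * A - (τ - 1) ^ 2 * D - τ * B := by
  have h1 : τ * τ⁻¹ = 1 := mul_inv_cancel₀ hτ
  have h2 : τ ^ 2 * (τ ^ 2)⁻¹ = 1 := mul_inv_cancel₀ (pow_ne_zero 2 hτ)
  linear_combination (-τ ^ 2) * hid - (τ - 1) * (C - D) * h2 + (τ - 1) * τ * (2 * B - D) * h1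

/-- **The Ricci-level condition gives the curvature-level sign condition** (pure algebra): if `1 < τ`,
`2A = B + (τ − 1)[τ⁻²(C − D) − τ⁻¹(2B − D)]` and `(τ − 1)²D + τB ≤ 2τ²A`, then `0 ≤ C − τB`. -/
theorem ricciLevel_excess_nonneg_of_le {A B C D τ : ℝ} (hτ : 1 < τ)
    (hid : 2 * A = B + (τ - 1) * ((τ ^ 2)⁻¹ * (C - D) - τ⁻¹ * (2 * B - D)))
    (hle : (τ - 1) ^ 2 * D + τ * B ≤ 2 * τ ^ 2 * A) : 0 ≤ C - τ * B := by
  have hkey := ricciLevel_excess_mul_eq (by linarith : τ ≠ 0) hid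
  have hprod : 0 ≤ (τ - 1) * (C - τ * B) := by rw [hkey]; linarith
  exact nonneg_of_mul_nonneg_right hprod (by linarith)

/-! ## From the Ricci level to the monotone cone-excess profile (over `g.riemVolume`, n = 4) -/

section RiemVolume

variable {M : Type} [TopologicalSpace M] [T2Space M] [SecondCountableTopology M]
  [ChartedSpace (EuclideanSpace ℝ (Fin 4)) M] [IsManifold (𝓡 4) ∞ M] [ConnectedSpace M]
  [T3Space M] [MeasurableSpace M] [BorelSpace M]

/-- **The curvature-level sign condition from the Ricci-level condition** (over `g.riemVolume`): on a
complete connected normalised 4-d gradient shrinker on which `|Ric|² e^{-f/τ}` and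
`g⁻¹(dR, df) e^{-f/τ}` are integrable for every `τ > 0` and
`(τ − 1)² ∫ R² e^{-f/τ} + τ ∫ R e^{-f/τ} ≤ 2τ² ∫ |Ric|² e^{-f/τ}` for every `τ > 1`, one has
`0 ≤ ∫ (f − τ) R e^{-f/τ}` for every `τ > 1`: by the Ricci moment identity (`ricciMoment_riemVolume`)
`(τ − 1)(∫ f R e^{-f/τ} − τ ∫ R e^{-f/τ}) = 2τ² ∫ |Ric|² e^{-f/τ} − (τ − 1)² ∫ R² e^{-f/τ} − τ ∫ R e^{-f/τ}`
and `∫ (f − τ) R e^{-f/τ} = ∫ f R e^{-f/τ} − τ ∫ R e^{-f/τ}` (`coneExcessMono_excess_eq`). -/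
theorem ricciLevel_excess_nonneg
    (g : PseudoRiemannianMetric (𝓡 4) ∞ (EuclideanSpace ℝ (Fin 4)) (TangentSpace (𝓡 4) : M → Type _))
    [g.HasLeviCivita] (f : M → ℝ) (hg : g.IsRiemannian)
    (hc : ∀ (x : M) (r : NNReal), IsCompact {y : M | g.edist hg x y ≤ r})
    (hf : ContMDiff (𝓡 4) 𝓘(ℝ, ℝ) ∞ f)
    (hsol : ∀ (x : M) (X Y : TangentSpace (𝓡 4) x),
      g.ricci x X Y + g.hessian f x X Y = (1 / 2 : ℝ) * g.val x X Y)
    (hnorm : ∀ x : M, g.scalarCurvature x + g.gradSq f x = f x)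
    (hInt : ∀ τ : ℝ, 0 < τ →
      Integrable (fun x ↦ g.normSq x (g.ricci x) * Real.exp (-f x / τ)) g.riemVolume ∧
      Integrable (fun x ↦ g.innerDual x (mvfderiv (𝓡 4) g.scalarCurvature x).toLinearMap
        (mvfderiv (𝓡 4) f x).toLinearMap * Real.exp (-f x / τ)) g.riemVolume)
    (hRL : ∀ τ : ℝ, 1 < τ →
      (τ - 1) ^ 2 * (∫ x, g.scalarCurvature x ^ 2 * Real.exp (-f x / τ) ∂g.riemVolume) +
        τ * (∫ x, g.scalarCurvature x * Real.exp (-f x / τ) ∂g.riemVolume) ≤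
      2 * τ ^ 2 * ∫ x, g.normSq x (g.ricci x) * Real.exp (-f x / τ) ∂g.riemVolume)
    {τ : ℝ} (hτ : 1 < τ) :
    0 ≤ ∫ x, (f x - τ) * g.scalarCurvature x * Real.exp (-f x / τ) ∂g.riemVolume := by
  have hτ0 : 0 < τ := one_pos.trans hτ
  obtain ⟨hRic, hX⟩ := hInt τ hτ0
  rw [coneExcessMono_excess_eq g f hg hc hf hsol hnorm hτ0]
  exact ricciLevel_excess_nonneg_of_le hτ (ricciMoment_riemVolume g f hg hc hf hsol hnorm hτ0 hRic hX)
    (hRL τ hτ)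

/-- **Monotonicity of the cone-excess profile from the sign condition in the interior** (over
`g.riemVolume`): on a complete connected normalised 4-d gradient shrinker, if
`∫ (f − τ) R e^{-f/τ} dV ≥ 0` for every `τ > 1`, then `τ ↦ τ ⟨R⟩_τ` is non-decreasing on `[1, ∞)` —
the proof of `coneExcessMono_monotoneOn` (`τ Z² m′ = Z (G − τ N) + (τ − 1) N² ≥ 0` in the interior
`(1, ∞)` by `coneExcessMono_hasDerivAt`, `secondWeightedIdentity_firstIdentity`,
`coneExcessMono_derivValue_nonneg`, and the mean value theorem `monotoneOn_of_deriv_nonneg`), which only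
uses the sign condition at `τ > 1`. -/
theorem coneExcessMono_monotoneOn_of_Ioi
    (g : PseudoRiemannianMetric (𝓡 4) ∞ (EuclideanSpace ℝ (Fin 4)) (TangentSpace (𝓡 4) : M → Type _))
    [g.HasLeviCivita] (f : M → ℝ) (hg : g.IsRiemannian)
    (hc : ∀ (x : M) (r : NNReal), IsCompact {y : M | g.edist hg x y ≤ r})
    (hf : ContMDiff (𝓡 4) 𝓘(ℝ, ℝ) ∞ f)
    (hsol : ∀ (x : M) (X Y : TangentSpace (𝓡 4) x),
      g.ricci x X Y + g.hessian f x X Y = (1 / 2 : ℝ) * g.val x X Y)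
    (hnorm : ∀ x : M, g.scalarCurvature x + g.gradSq f x = f x)
    (hP : ∀ τ : ℝ, 1 < τ →
      0 ≤ ∫ x, (f x - τ) * g.scalarCurvature x * Real.exp (-f x / τ) ∂g.riemVolume) :
    MonotoneOn (fun τ : ℝ ↦ τ * ((∫ x, g.scalarCurvature x * Real.exp (-f x / τ) ∂g.riemVolume) /
      (∫ x, Real.exp (-f x / τ) ∂g.riemVolume))) (Ici 1) := by
  -- adapted from `coneExcessMono_monotoneOn` (EntropyRungConicalGapConeExcessMonotone.lean)
  have hder := fun τ (hτ : 0 < τ) ↦ coneExcessMono_hasDerivAt g f hg hc hf hsol hnorm hτ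
  refine monotoneOn_of_deriv_nonneg (convex_Ici 1) (fun τ hτ ↦ ?_) ?_ ?_
  · exact (hder τ (lt_of_lt_of_le one_pos (mem_Ici.mp hτ))).continuousAt.continuousWithinAt
  · rw [interior_Ici]
    exact fun τ hτ ↦ (hder τ (lt_trans one_pos (mem_Ioi.mp hτ))).differentiableAt.differentiableWithinAt
  · rw [interior_Ici]
    intro τ hτ
    have hτ1 : 1 < τ := mem_Ioi.mp hτ
    have hτ0 : 0 < τ := lt_trans one_pos hτ1
    rw [(hder τ hτ0).deriv]
    obtain ⟨hR0, -, hprop⟩ :=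
      NoncompactShrinkerGapCarrilloNiClauses.scalarCurvature_nonneg_and_isCompact_sublevel g f hg hc hf
        hsol hnorm
    have hZpos : 0 < ∫ x, Real.exp (-f x / τ) ∂g.riemVolume :=
      selfSimilar_weight_pos g f hg τ (weightedIntegrability_riemVolume hg hf hsol hnorm hprop hR0 hτ0).1
    have hid := secondWeightedIdentity_firstIdentity g f hg hc hf hsol hnorm hτ0
    have hPτ := hP τ hτ1
    rw [coneExcessMono_excess_eq g f hg hc hf hsol hnorm hτ0] at hPτ
    exact coneExcessMono_derivValue_nonneg hZpos hτ1.le hid hPτ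

/-- **The Ricci-level fence** (over `g.riemVolume`): on a complete connected normalised 4-d gradient
shrinker satisfying the integrability of `|Ric|² e^{-f/τ}`, `g⁻¹(dR, df) e^{-f/τ}` (`τ > 0`) and the
Ricci-level condition `(τ − 1)² ∫ R² e^{-f/τ} + τ ∫ R e^{-f/τ} ≤ 2τ² ∫ |Ric|² e^{-f/τ}` (`τ > 1`), if
`(16π²T²)⁻¹ ∫ e^{-f/T} → a` and `T⟨R⟩_T → ρ` then `∫ e^{-f} ≤ 16π² · a · e^{ρ/2}`
(`ricciLevel_excess_nonneg`, `coneExcessMono_monotoneOn_of_Ioi`, `HalfSup.density_le_of_monotone`). -/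
theorem ricciLevel_density_le
    (g : PseudoRiemannianMetric (𝓡 4) ∞ (EuclideanSpace ℝ (Fin 4)) (TangentSpace (𝓡 4) : M → Type _))
    [g.HasLeviCivita] (f : M → ℝ) (hg : g.IsRiemannian)
    (hc : ∀ (x : M) (r : NNReal), IsCompact {y : M | g.edist hg x y ≤ r})
    (hf : ContMDiff (𝓡 4) 𝓘(ℝ, ℝ) ∞ f)
    (hsol : ∀ (x : M) (X Y : TangentSpace (𝓡 4) x),
      g.ricci x X Y + g.hessian f x X Y = (1 / 2 : ℝ) * g.val x X Y)
    (hnorm : ∀ x : M, g.scalarCurvature x + g.gradSq f x = f x)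
    (hInt : ∀ τ : ℝ, 0 < τ →
      Integrable (fun x ↦ g.normSq x (g.ricci x) * Real.exp (-f x / τ)) g.riemVolume ∧
      Integrable (fun x ↦ g.innerDual x (mvfderiv (𝓡 4) g.scalarCurvature x).toLinearMap
        (mvfderiv (𝓡 4) f x).toLinearMap * Real.exp (-f x / τ)) g.riemVolume)
    (hRL : ∀ τ : ℝ, 1 < τ →
      (τ - 1) ^ 2 * (∫ x, g.scalarCurvature x ^ 2 * Real.exp (-f x / τ) ∂g.riemVolume) +
        τ * (∫ x, g.scalarCurvature x * Real.exp (-f x / τ) ∂g.riemVolume) ≤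
      2 * τ ^ 2 * ∫ x, g.normSq x (g.ricci x) * Real.exp (-f x / τ) ∂g.riemVolume)
    {a ρ : ℝ}
    (ha : Tendsto (fun T : ℝ ↦ (16 * Real.pi ^ 2 * T ^ 2)⁻¹ * ∫ x, Real.exp (-f x / T) ∂g.riemVolume)
      atTop (𝓝 a))
    (hρ : Tendsto (fun T : ℝ ↦ T * ((∫ x, g.scalarCurvature x * Real.exp (-f x / T) ∂g.riemVolume) /
      (∫ x, Real.exp (-f x / T) ∂g.riemVolume))) atTop (𝓝 ρ)) :
    ∫ x, Real.exp (-f x) ∂g.riemVolume ≤ 16 * Real.pi ^ 2 * a * Real.exp (ρ / 2) := by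
  have hmono := coneExcessMono_monotoneOn_of_Ioi g f hg hc hf hsol hnorm
    (fun τ hτ ↦ ricciLevel_excess_nonneg g f hg hc hf hsol hnorm hInt hRL hτ)
  refine HalfSup.density_le_of_monotone g f hg hc hf hsol hnorm ha (fun τ τ' hτ hττ' ↦ ?_) hρ
  exact hmono (show τ ∈ Set.Ici (1 : ℝ) from hτ) (show τ' ∈ Set.Ici (1 : ℝ) from hτ.trans hττ') hττ'

end RiemVolume

/-! ## The registered helpers (crux vocabulary) -/

/-- **Helper `helper_density_le_of_ricciLevel` of line `Sketch` — the Ricci-level fence**: on every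
complete connected normalised 4-d gradient shrinking Ricci soliton on which `|Ric|² e^{-f/τ}` and
`g⁻¹(dR, df) e^{-f/τ}` are `dV`-integrable for all `τ > 0` and the RICCI-LEVEL CONDITION
`(τ − 1)² ∫ R² e^{-f/τ} dV + τ ∫ R e^{-f/τ} dV ≤ 2τ² ∫ |Ric|² e^{-f/τ} dV` holds for all `τ > 1`, if
`(16π²T²)⁻¹ ∫ e^{-f/T} dV → a` and `T⟨R⟩_T → ρ`, then `∫ e^{-f} dV ≤ 16π² · a · e^{ρ/2}`
(`dV` the Riemannian measure of `g.toContMDiffRiemannianMetric hg`, to which `g.riemVolume` unfolds by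
`riemVolume_eq`): the Ricci moment identity turns the Ricci-level condition at `τ > 1` into the
curvature-level sign condition `∫ (f − τ) R e^{-f/τ} dV ≥ 0`, whence the cone-excess profile is
non-decreasing on `[1, ∞)` and the half-sup fence applies (`ricciLevel_density_le`). -/
theorem helper_density_le_of_ricciLevel : ∀ (M : Type) [TopologicalSpace M] [T2Space M] [SecondCountableTopology M] [ChartedSpace (EuclideanSpace ℝ (Fin 4)) M] [IsManifold (𝓡 4) ∞ M] [ConnectedSpace M] [T3Space M] [MeasurableSpace M] [BorelSpace M] (g : Literature.Geometry.Lorentzian.PseudoRiemannianMetric (𝓡 4) ∞ (EuclideanSpace ℝ (Fin 4)) (TangentSpace (𝓡 4) : M → Type _)) [g.HasLeviCivita] (f : M → ℝ) (hg : g.IsRiemannian), (∀ (x : M) (r : NNReal), IsCompact {y : M | g.edist hg x y ≤ r}) → ContMDiff (𝓡 4) 𝓘(ℝ, ℝ) ∞ f → (∀ (x : M) (X Y : TangentSpace (𝓡 4) x), g.ricci x X Y + g.hessian f x X Y = (1 / 2 : ℝ) * g.val x X Y) → (∀ x : M, g.scalarCurvature x + g.gradSq f x = f x) → (∀ τ :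 ℝ, 0 < τ → MeasureTheory.Integrable (fun x ↦ g.normSq x (g.ricci x) * Real.exp (-f x / τ)) (Literature.Geometry.Lorentzian.riemannianMeasure (g.toContMDiffRiemannianMetric hg)) ∧ MeasureTheory.Integrable (fun x ↦ g.innerDual x (mvfderiv (𝓡 4) g.scalarCurvature x).toLinearMap (mvfderiv (𝓡 4) f x).toLinearMap * Real.exp (-f x / τ)) (Literature.Geometry.Lorentzian.riemannianMeasure (g.toContMDiffRiemannianMetric hg))) → (∀ τ : ℝ, 1 < τ → (τ - 1) ^ 2 * (∫ x, g.scalarCurvature x ^ 2 * Real.exp (-f x / τ) ∂(Literature.Geometry.Lorentzian.riemannianMeasure (g.toContMDiffRiemannianMetric hg))) + τ * (∫ x, g.scalarCurvature x * Real.exp (-f x / τ) ∂(Literature.Geometry.Lorentzian.riemannianMeasure (g.toContMDiffRiemannianMetric hg))) ≤ 2 * τ ^ 2 * ∫ x, g.normSq x (g.ricci x) * Real.exp (-f x / τ) ∂(Literature.Geometry.Lorentzian.riemannianMeasure (g.toContMDiffRiemannianMetric hg))) → ∀ a ρ : ℝ, Filter.Tendsto (fun T : ℝ ↦ (16 * Real.pi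 ^ 2 * T ^ 2)⁻¹ * ∫ x, Real.exp (-f x / T) ∂(Literature.Geometry.Lorentzian.riemannianMeasure (g.toContMDiffRiemannianMetric hg))) Filter.atTop (nhds a) → Filter.Tendsto (fun T : ℝ ↦ T * ((∫ x, g.scalarCurvature x * Real.exp (-f x / T) ∂(Literature.Geometry.Lorentzian.riemannianMeasure (g.toContMDiffRiemannianMetric hg))) / (∫ x, Real.exp (-f x / T) ∂(Literature.Geometry.Lorentzian.riemannianMeasure (g.toContMDiffRiemannianMetric hg))))) Filter.atTop (nhds ρ) → ∫ x, Real.exp (-f x) ∂(Literature.Geometry.Lorentzian.riemannianMeasure (g.toContMDiffRiemannianMetric hg)) ≤ 16 * Real.pi ^ 2 * a * Real.exp (ρ / 2) := by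
  intro M _ _ _ _ _ _ _ _ _ g _ f hg hc hf hsol hnorm hInt hRL a ρ ha hρ
  rw [← PseudoRiemannianMetric.riemVolume_eq hg] at hInt hRL ha hρ ⊢
  exact ricciLevel_density_le g f hg hc hf hsol hnorm hInt hRL ha hρ

/-- **Helper `helper_conicalGap_of_ricciLevel` of line `Sketch` — the crux on the RICCI-LEVEL
sub-class**: a shrinker of the crux class (complete connected non-compact non-flat normalised 4-d
gradient shrinker with `R → 0` at infinity) on which `|Ric|² e^{-f/τ}` and `g⁻¹(dR, df) e^{-f/τ}` are
`dV`-integrable (`τ > 0`), the Ricci-level condition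
`(τ − 1)² ∫ R² e^{-f/τ} dV + τ ∫ R e^{-f/τ} dV ≤ 2τ² ∫ |Ric|² e^{-f/τ} dV` holds (`τ > 1`), with
regularised AVR `a`, cone excess `ρ = lim T⟨R⟩_T` and `16π² a e^{ρ/2} ≤ 32π²√π e^{-3/2}`, satisfies the
conclusion of `EntropyRung.ConicalGap` (`helper_density_le_of_ricciLevel`; non-flatness,
non-compactness and the decay clause are not used). -/
theorem helper_conicalGap_of_ricciLevel : ∀ (M : Type) [TopologicalSpace M] [T2Space M] [SecondCountableTopology M] [ChartedSpace (EuclideanSpace ℝ (Fin 4)) M] [IsManifold (𝓡 4) ∞ M] [ConnectedSpace M] [NoncompactSpace M] [T3Space M] [MeasurableSpace M] [BorelSpace M] (g : Literature.Geometry.Lorentzian.PseudoRiemannianMetric (𝓡 4) ∞ (EuclideanSpace ℝ (Fin 4)) (TangentSpace (𝓡 4) : M → Type _)) [g.HasLeviCivita] (f : M → ℝ) (hg : g.IsRiemannian), (∀ (x : M) (r : NNReal), IsCompact {y : M | g.edist hg x y ≤ r}) → ContMDiff (𝓡 4) 𝓘(ℝ, ℝ) ∞ f → (∀ (x : M) (X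 Y : TangentSpace (𝓡 4) x), g.ricci x X Y + g.hessian f x X Y = (1 / 2 : ℝ) * g.val x X Y) → (∀ x : M, g.scalarCurvature x + g.gradSq f x = f x) → (∃ x : M, g.scalarCurvature x ≠ 0) → (∀ ε : ℝ, 0 < ε → ∃ K : Set M, IsCompact K ∧ ∀ x, x ∉ K → g.scalarCurvature x < ε) → (∀ τ : ℝ, 0 < τ → MeasureTheory.Integrable (fun x ↦ g.normSq x (g.ricci x) * Real.exp (-f x / τ)) (Literature.Geometry.Lorentzian.riemannianMeasure (g.toContMDiffRiemannianMetric hg)) ∧ MeasureTheory.Integrable (fun x ↦ g.innerDual x (mvfderiv (𝓡 4) g.scalarCurvature x).toLinearMap (mvfderiv (𝓡 4) f x).toLinearMap * Real.exp (-f x / τ)) (Literature.Geometry.Lorentzian.riemannianMeasure (g.toContMDiffRiemannianMetric hg))) → (∀ τ : ℝ, 1 < τ → (τ - 1) ^ 2 * (∫ x, g.scalarCurvature x ^ 2 * Real.exp (-f x / τ) ∂(Literature.Geometry.Lorentzian.riemannianMeasure (g.toContMDiffRiemannianMetric hg))) + τ * (∫ x, g.scalarCurvature x * Real.exp (-f x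 / τ) ∂(Literature.Geometry.Lorentzian.riemannianMeasure (g.toContMDiffRiemannianMetric hg))) ≤ 2 * τ ^ 2 * ∫ x, g.normSq x (g.ricci x) * Real.exp (-f x / τ) ∂(Literature.Geometry.Lorentzian.riemannianMeasure (g.toContMDiffRiemannianMetric hg))) → ∀ a ρ : ℝ, Filter.Tendsto (fun T : ℝ ↦ (16 * Real.pi ^ 2 * T ^ 2)⁻¹ * ∫ x, Real.exp (-f x / T) ∂(Literature.Geometry.Lorentzian.riemannianMeasure (g.toContMDiffRiemannianMetric hg))) Filter.atTop (nhds a) → Filter.Tendsto (fun T : ℝ ↦ T * ((∫ x, g.scalarCurvature x * Real.exp (-f x / T) ∂(Literature.Geometry.Lorentzian.riemannianMeasure (g.toContMDiffRiemannianMetric hg))) / (∫ x, Real.exp (-f x / T) ∂(Literature.Geometry.Lorentzian.riemannianMeasure (g.toContMDiffRiemannianMetric hg))))) Filter.atTop (nhds ρ) → 16 * Real.pi ^ 2 * a * Real.exp (ρ / 2) ≤ 32 * Real.pi ^ 2 * Real.sqrt Real.pi * Real.exp (-(3 : ℝ) / 2) → ∫⁻ x, ENNReal.ofReal (Real.exp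 (-f x)) ∂(Literature.Geometry.Lorentzian.riemannianMeasure (g.toContMDiffRiemannianMetric hg)) ≤ ENNReal.ofReal (32 * Real.pi ^ 2 * Real.sqrt Real.pi * Real.exp (-(3 : ℝ) / 2)) := by
  intro M _ _ _ _ _ _ _ _ _ _ g _ f hg hc hf hsol hnorm _ _ hInt hRL a ρ ha hρ hbudget
  have hfence := helper_density_le_of_ricciLevel M g f hg hc hf hsol hnorm hInt hRL a ρ ha hρ
  obtain ⟨hI1, -, -⟩ := stub_weightedIntegrability M g f hg hc hf hsol hnorm 1 one_pos
  have hI1' : Integrable (fun x ↦ Real.exp (-f x))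
      (riemannianMeasure (g.toContMDiffRiemannianMetric hg)) := by
    simpa only [div_one] using hI1
  rw [← ofReal_integral_eq_lintegral_ofReal hI1' (ae_of_all _ fun x ↦ (Real.exp_pos _).le)]
  exact ENNReal.ofReal_le_ofReal (hfence.trans hbudget)

end Summit.SmoothPoincare4.SmoothPoincare4.Theorems.ConicalGapSketch

end
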